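import Literature.Computability.Complexity.GaussRankFP
import Literature.Computability.Complexity.CodeFPFinite
import Literature.Computability.Complexity.CodeFPBudgets
import Literature.Computability.MetaComplexity.GFDesignList
import HarnessLib

/-!
# NW designs computable in `AC⁰[p]`: the list program of `GFDesignList.lean` runs in polynomial time

Sequel of `GFDesignList.lean` (the field `𝔽_p[X]/(P)`, the search for `P` and the column values of
the concrete design `designC` as a functional program on coefficient lists). This file proves, in
the typed algebra `CodeFP` of `CodeFP.lean` (maps between encoded types computed on codes by
polynomial-time string functions), that every function of that program is polynomial time — the
`P`-uniformity half of CIKK Thm. 3.6 ("such a field … can be found by exhaustive search in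
`poly(n)` time") and the machine behind the learner's design layer:

* residues `zmodE p` and rows `rowE p = rawE (zmodE p)` (from `GaussRankFP.lean`); `zmodAdd`,
  `zmodNeg`; list arithmetic `codeFP_addL`, `codeFP_smulL`, `codeFP_mulXmodL`, the product loop
  `codeFP_mulmodL` and the evaluation loop `codeFP_polyValL` (folds whose states stay LINEAR:
  lengths never exceed those of the inputs, entries are reduced residues —
  `length_foldl_mulStep_le`, `length_foldl_pvStep_le`);
* digits `codeFP_digitsL`, the index `codeFP_idxL` (a fold carrying `pʲ`), `codeFP_monicL`;
* the reducibility test `codeFP_reducibleL` (three nested `any`s), the search `codeFP_irredSearch`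
  (`find?`), the exponent `codeFP_tOf` (a `filter`), the modulus `codeFP_qOf`, the bit string
  `codeFP_bitsOf` and **`codeFP_colValL`**: the column value `(1^Q, 1^ℓ, vbits, τ) ↦ colValL p Q ℓ vbits τ`
  is computed on codes in polynomial time.

All statements are proved; no machine is written beyond the typed combinators.

## References

* M. Carmosino, R. Impagliazzo, V. Kabanets, A. Kolokolova, *Learning algorithms from natural
  proofs*, CCC 2016, LIPIcs 50, Thm. 3.6 (proof) [CarmosinoImpagliazzoKabanetsKolokolova2016].
* S. Arora, B. Barak, *Computational Complexity: A Modern Approach*, CUP 2009, §1.3 (polynomial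
  time is closed under composition and polynomially bounded loops) [AroraBarak2009].
-/

namespace Literature.Computability.MetaComplexity

namespace GFDesign

open _root_.Computability Polynomial Literature.Computability.Complexity
  Literature.Computability.Complexity.CodeFP Literature.Computability.Complexity.Brick
  Literature.Computability.Complexity.GaussRank

variable {p : ℕ} [hp : Fact p.Prime]

/-! ### Residues -/

/-- Addition of residues. [folklore] -/
theorem zmodAdd : CodeFP (pairE (zmodE p) (zmodE p)) (zmodE p) (fun q => q.1 + q.2) :=
  (zmodOfNat.comp (natAdd.comp ((zmodVal.comp (fst _ _)).pair (zmodVal.comp (snd _ _))))).congr fun q => by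
    push_cast; rw [ZMod.natCast_zmod_val, ZMod.natCast_zmod_val]

/-- Negation of residues. [folklore] -/
theorem zmodNeg : CodeFP (zmodE p) (zmodE p) (fun x => -x) :=
  (zmodSub.comp ((const _ (0 : ZMod p)).pair (CodeFP.id _))).congr fun x => by simp

/-! ### Bounds on row codes -/

/-- A row of length `≤ n` has code length `≤ n (2·entryLen + 2)`. [folklore] -/
theorem length_rowE_le_of_le {r : List (ZMod p)} {n : ℕ} (h : r.length ≤ n) :
    (rowE p r).length ≤ n * (2 * entryLen p + 2) :=
  (length_rowE_le r).trans (Nat.mul_le_mul_right _ h)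

/-! ### List arithmetic -/

/-- `addL` on codes. [folklore] -/
theorem codeFP_addL : CodeFP (pairE (rowE p) (rowE p)) (rowE p) (fun q => addL p q.1 q.2) := by
  have hz := zipWith (σ := Unit) (eσ := unitE) (eα := zmodE p) (eβ := zmodE p) (eγ := zmodE p)
    (g := fun t => t.2.1 + t.2.2) (zmodAdd.comp (snd _ _))
  exact (hz.comp ((const _ ()).pair (CodeFP.id _))).congr fun q => rfl

/-- `smulL` on codes. [folklore] -/
theorem codeFP_smulL : CodeFP (pairE (zmodE p) (rowE p)) (rowE p) (fun q => smulL p q.1 q.2) := by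
  have hm := map (σ := ZMod p) (α := ZMod p) (eσ := zmodE p) (eα := zmodE p) (eβ := zmodE p)
    (g := fun t => t.1 * t.2) zmodMul
  exact hm.congr fun q => rfl

omit hp in
/-- `|q| - 1` in unary from the row `q`. [folklore] -/
theorem codeFP_predLength : CodeFP (rowE p) unE (fun q : List (ZMod p) => q.length - 1) :=
  (unOfNatMin.comp ((ulength (zmodE p)).pair (natSub.comp ((natLength (zmodE p)).pair (const _ 1))))).congr
    fun q => by simp
set_option maxHeartbeats 400000 in -- buildfix (bf3-g31): 160k/180k FAIL, 200k PASS at accept time; line-neutral budget line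
/-- **`mulXmodL` on codes**: `(q, l) ↦ X · l mod (Xᵗ + q)`. [folklore] -/
theorem codeFP_mulXmodL : CodeFP (pairE (rowE p) (rowE p)) (rowE p) (fun q => mulXmodL p q.1 q.2) := by
  have hq : CodeFP (pairE (rowE p) (rowE p)) (rowE p) (fun t => t.1) := fst _ _
  have hl : CodeFP (pairE (rowE p) (rowE p)) (rowE p) (fun t => t.2) := snd _ _
  have hn : CodeFP (pairE (rowE p) (rowE p)) unE (fun t => t.1.length - 1) := codeFP_predLength.comp hq
  have hnb : CodeFP (pairE (rowE p) (rowE p)) natE (fun t => t.1.length - 1) :=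
    natSub.comp (((natLength (zmodE p)).comp hq).pair (const _ 1))
  have htake : CodeFP (pairE (rowE p) (rowE p)) (rowE p) (fun t => t.2.take (t.1.length - 1)) :=
    (rawTakeUn (zmodE p)).comp (hn.pair hl)
  have hget : CodeFP (pairE (rowE p) (rowE p)) (zmodE p) (fun t => t.2.getD (t.1.length - 1) 0) :=
    (rawGetD (zmodE p) (d := (0 : ZMod p)) zmodE_zero).comp (hl.pair hnb)
  have hcons : CodeFP (pairE (rowE p) (rowE p)) (rowE p) (fun t => (0 : ZMod p) :: t.2.take (t.1.length - 1)) :=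
    (rawCons (zmodE p)).comp ((const _ (0 : ZMod p)).pair htake)
  have hsm : CodeFP (pairE (rowE p) (rowE p)) (rowE p) (fun t => smulL p (-(t.2.getD (t.1.length - 1) 0)) t.1) :=
    codeFP_smulL.comp ((zmodNeg.comp hget).pair hq)
  exact (codeFP_addL.comp (hcons.pair hsm)).congr fun t => rfl

/-- **The product step on codes**, context `q`, item `c`, state `s`. [folklore] -/
theorem codeFP_mulStep :
    CodeFP (pairE (rowE p) (pairE (zmodE p) (pairE (rowE p) (rowE p)))) (pairE (rowE p) (rowE p))
      (fun t => mulStep p t.1 t.2.2 t.2.1) := by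
  have hq : CodeFP (pairE (rowE p) (pairE (zmodE p) (pairE (rowE p) (rowE p)))) (rowE p) (fun t => t.1) := fst _ _
  have hc : CodeFP (pairE (rowE p) (pairE (zmodE p) (pairE (rowE p) (rowE p)))) (zmodE p) (fun t => t.2.1) :=
    (snd _ _).fst'
  have hs1 : CodeFP (pairE (rowE p) (pairE (zmodE p) (pairE (rowE p) (rowE p)))) (rowE p) (fun t => t.2.2.1) :=
    (snd _ _).snd'.fst'
  have hs2 : CodeFP (pairE (rowE p) (pairE (zmodE p) (pairE (rowE p) (rowE p)))) (rowE p) (fun t => t.2.2.2) :=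
    (snd _ _).snd'.snd'
  exact ((codeFP_addL.comp (hs1.pair (codeFP_smulL.comp (hc.pair hs2)))).pair
    (codeFP_mulXmodL.comp (hq.pair hs2))).congr fun t => rfl

omit hp in
/-- Along the product loop the state lengths never exceed those of the inputs. [folklore] -/
theorem length_foldl_mulStep_le (q l : List (ZMod p)) :
    ∀ (m : List (ZMod p)) (s : List (ZMod p) × List (ZMod p)), s.1.length ≤ q.length → s.2.length ≤ q.length + l.length →
      (m.foldl (mulStep p q) s).1.length ≤ q.length ∧ (m.foldl (mulStep p q) s).2.length ≤ q.length + l.length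
  | [], _, h1, h2 => ⟨h1, h2⟩
  | c :: m, s, h1, h2 => by
    rw [List.foldl_cons]
    refine length_foldl_mulStep_le q l m _ ?_ ?_
    · simp only [mulStep, length_addL]; exact (min_le_left _ _).trans h1
    · simp only [mulStep, mulXmodL, length_addL, length_smulL]; exact (min_le_right _ _).trans (by omega)

/-- **`mulmodL` on codes**: `(q, l, m) ↦ l · m mod (Xᵗ + q)`. [folklore] -/
theorem codeFP_mulmodL :
    CodeFP (pairE (rowE p) (pairE (rowE p) (rowE p))) (rowE p) (fun t => mulmodL p t.1 t.2.1 t.2.2) := by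
  -- context `σ = (q, l)`, items of `m`, state pair
  have hstep : CodeFP (pairE (pairE (rowE p) (rowE p)) (pairE (zmodE p) (pairE (rowE p) (rowE p))))
      (pairE (rowE p) (rowE p)) (fun t => mulStep p t.1.1 t.2.2 t.2.1) :=
    codeFP_mulStep.comp ((fst _ _).fst'.pair (snd _ _))
  have hinit : CodeFP (pairE (rowE p) (rowE p)) (pairE (rowE p) (rowE p))
      (fun s => (List.replicate s.1.length (0 : ZMod p), s.2)) :=
    ((replicateOf (zmodE p)).comp ((const _ (0 : ZMod p)).pair ((ulength (zmodE p)).comp (fst _ _)))).pair (snd _ _)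
  have h := foldl (σ := List (ZMod p) × List (ZMod p)) (α := ZMod p) (β := List (ZMod p) × List (ZMod p))
    (eσ := pairE (rowE p) (rowE p)) (eα := zmodE p) (eβ := pairE (rowE p) (rowE p))
    (step := fun s c st => mulStep p s.1 st c) (init := fun s => (List.replicate s.1.length 0, s.2)) hstep hinit
    (C (2 * entryLen p + 3) * X + C 4) (fun s m₁ m₂ => by
      obtain ⟨q, l⟩ := s
      obtain ⟨h1, h2⟩ := length_foldl_mulStep_le (p := p) q l m₁ (List.replicate q.length 0, l) (by simp) (by simp)
      set st := m₁.foldl (mulStep p q) (List.replicate q.length 0, l)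
      have b1 := two_mul_length_le_length_rowE (p := p) q
      have b2 := two_mul_length_le_length_rowE (p := p) l
      have e1 : (rowE p st.1).length ≤ (rowE p q).length * (entryLen p + 1) :=
        (length_rowE_le_of_le h1).trans (by
          calc q.length * (2 * entryLen p + 2) = 2 * q.length * (entryLen p + 1) := by ring
            _ ≤ (rowE p q).length * (entryLen p + 1) := Nat.mul_le_mul_right _ b1)
      have e2 : (rowE p st.2).length ≤ ((rowE p q).length + (rowE p l).length) * (entryLen p + 1) :=
        (length_rowE_le_of_le h2).trans (by
          calc (q.length + l.length) * (2 * entryLen p + 2) = (2 * q.length + 2 * l.length) * (entryLen p + 1) := by ring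
            _ ≤ ((rowE p q).length + (rowE p l).length) * (entryLen p + 1) := Nat.mul_le_mul_right _ (by omega))
      simp only [pairE_apply, length_boolPair, eval_add, eval_mul, eval_C, eval_X]
      nlinarith [e1, e2, Nat.zero_le ((rawE (zmodE p) (m₁ ++ m₂)).length), Nat.zero_le (entryLen p)])
  exact (h.fst'.comp (((fst _ _).pair (snd _ _).fst').pair (snd _ _).snd')).congr fun t => rfl

/-! ### The evaluation loop -/

/-- `oneL |q|` from the row `q`. [folklore] -/
theorem codeFP_oneL : CodeFP (rowE p) (rowE p) (fun q : List (ZMod p) => oneL p q.length) :=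
  ((setAt (zmodE p)).comp (((replicateOf (zmodE p)).comp ((const _ (0 : ZMod p)).pair (ulength (zmodE p)))).pair
    ((const _ 0).pair (const _ (1 : ZMod p))))).congr fun _ => rfl

/-- **The evaluation step on codes**, context `(q, r)`, item `b`, state `s`. [folklore] -/
theorem codeFP_pvStep :
    CodeFP (pairE (pairE (rowE p) (rowE p)) (pairE bitE (pairE (rowE p) (rowE p)))) (pairE (rowE p) (rowE p))
      (fun t => pvStep p t.1.1 t.1.2 t.2.2 t.2.1) := by
  have hq : CodeFP (pairE (pairE (rowE p) (rowE p)) (pairE bitE (pairE (rowE p) (rowE p)))) (rowE p) (fun t => t.1.1) :=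
    (fst _ _).fst'
  have hr : CodeFP (pairE (pairE (rowE p) (rowE p)) (pairE bitE (pairE (rowE p) (rowE p)))) (rowE p) (fun t => t.1.2) :=
    (fst _ _).snd'
  have hb : CodeFP (pairE (pairE (rowE p) (rowE p)) (pairE bitE (pairE (rowE p) (rowE p)))) bitE (fun t => t.2.1) :=
    (snd _ _).fst'
  have hs1 : CodeFP (pairE (pairE (rowE p) (rowE p)) (pairE bitE (pairE (rowE p) (rowE p)))) (rowE p) (fun t => t.2.2.1) :=
    (snd _ _).snd'.fst'
  have hs2 : CodeFP (pairE (pairE (rowE p) (rowE p)) (pairE bitE (pairE (rowE p) (rowE p)))) (rowE p) (fun t => t.2.2.2) :=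
    (snd _ _).snd'.snd'
  exact ((hb.ite (codeFP_addL.comp (hs1.pair hs2)) hs1).pair (codeFP_mulmodL.comp (hq.pair (hs2.pair hr)))).congr fun t => rfl

omit hp in
/-- Along the evaluation loop both state lengths stay `≤ |q|`. [folklore] -/
theorem length_foldl_pvStep_le (q r : List (ZMod p)) :
    ∀ (bits : List Bool) (s : List (ZMod p) × List (ZMod p)), s.1.length ≤ q.length → s.2.length ≤ q.length →
      (bits.foldl (pvStep p q r) s).1.length ≤ q.length ∧ (bits.foldl (pvStep p q r) s).2.length ≤ q.length
  | [], _, h1, h2 => ⟨h1, h2⟩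
  | b :: bits, s, h1, h2 => by
    rw [List.foldl_cons]
    refine length_foldl_pvStep_le q r bits _ ?_ ?_
    · cases b
      · exact h1
      · simp only [pvStep, if_true, length_addL]; exact (min_le_left _ _).trans h1
    · simp only [pvStep, mulmodL]
      exact (length_foldl_mulStep_le q s.2 r _ (by simp) (by simp)).1

/-- **`polyValL` on codes**: `(q, bits, r) ↦ Σ_{j : bits[j]} rʲ mod (Xᵗ + q)`. [folklore] -/
theorem codeFP_polyValL :
    CodeFP (pairE (rowE p) (pairE (rawE bitE) (rowE p))) (rowE p) (fun t => polyValL p t.1 t.2.1 t.2.2) := by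
  have hstep : CodeFP (pairE (pairE (rowE p) (rowE p)) (pairE bitE (pairE (rowE p) (rowE p)))) (pairE (rowE p) (rowE p))
      (fun t => pvStep p t.1.1 t.1.2 t.2.2 t.2.1) := codeFP_pvStep
  have hinit : CodeFP (pairE (rowE p) (rowE p)) (pairE (rowE p) (rowE p))
      (fun s => (List.replicate s.1.length (0 : ZMod p), oneL p s.1.length)) :=
    ((replicateOf (zmodE p)).comp ((const _ (0 : ZMod p)).pair ((ulength (zmodE p)).comp (fst _ _)))).pair
      (codeFP_oneL.comp (fst _ _))
  have h := foldl (σ := List (ZMod p) × List (ZMod p)) (α := Bool) (β := List (ZMod p) × List (ZMod p))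
    (eσ := pairE (rowE p) (rowE p)) (eα := bitE) (eβ := pairE (rowE p) (rowE p))
    (step := fun s b st => pvStep p s.1 s.2 st b) (init := fun s => (List.replicate s.1.length 0, oneL p s.1.length)) hstep hinit
    (C (2 * entryLen p + 2) * X + C 4) (fun s b₁ b₂ => by
      obtain ⟨q, r⟩ := s
      obtain ⟨h1, h2⟩ := length_foldl_pvStep_le (p := p) q r b₁ (List.replicate q.length 0, oneL p q.length) (by simp) (by simp)
      set st := b₁.foldl (pvStep p q r) (List.replicate q.length 0, oneL p q.length)
      have b1 := two_mul_length_le_length_rowE (p := p) q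
      have e : ∀ {x : List (ZMod p)}, x.length ≤ q.length → (rowE p x).length ≤ (rowE p q).length * (entryLen p + 1) :=
        fun hx => (length_rowE_le_of_le hx).trans (by
          calc q.length * (2 * entryLen p + 2) = 2 * q.length * (entryLen p + 1) := by ring
            _ ≤ (rowE p q).length * (entryLen p + 1) := Nat.mul_le_mul_right _ b1)
      have e1 := e h1
      have e2 := e h2
      simp only [pairE_apply, length_boolPair, eval_add, eval_mul, eval_C, eval_X]
      nlinarith [e1, e2, Nat.zero_le ((rowE p r).length), Nat.zero_le ((rawE bitE (b₁ ++ b₂)).length), Nat.zero_le (entryLen p)])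
  exact (h.fst'.comp (((fst _ _).pair (snd _ _).snd').pair (snd _ _).fst')).congr fun t => rfl

/-! ### Small list identities used to remove caps inside loops -/

omit hp in
/-- `any` only depends on the values of the predicate on members. [folklore] -/
theorem any_congr_mem {α : Type} {l : List α} {f g : α → Bool} (h : ∀ a ∈ l, f a = g a) : l.any f = l.any g := by
  induction l with
  | nil => rfl
  | cons a l ih =>
    rw [List.any_cons, List.any_cons, h a (by simp), ih fun b hb => h b (by simp [hb])]

omit hp in
/-- `List.ofFn` over `Fin n` is a `map` over `List.range n`. [folklore] -/
private theorem ofFn_eq_map_range {α : Type} {n : ℕ} (g : ℕ → α) : (List.ofFn fun j : Fin n => g j) = (List.range n).map g := by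
  refine List.ext_getElem (by simp) fun i h₁ h₂ => ?_
  simp

/-! ### Digits and the index -/

/-- `digitsL` is a `map` over the index range. [folklore] -/
theorem digitsL_eq_map (t i : ℕ) : digitsL p t i = (List.range t).map fun j => ((i / p ^ j % p : ℕ) : ZMod p) := by
  unfold digitsL
  exact ofFn_eq_map_range (fun n : ℕ => ((i / p ^ n % p : ℕ) : ZMod p))

/-- **`digitsL` on codes**: `(1ᵗ, i) ↦` the `t` base-`p` digits of `i`. [folklore] -/
theorem codeFP_digitsL : CodeFP (pairE unE natE) (rowE p) (fun x => digitsL p x.1 x.2) := by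
  -- context `(1ᵗ, i)`, item `j`
  have ht : CodeFP (pairE (pairE unE natE) natE) unE (fun y => y.1.1) := (fst _ _).fst'
  have hi : CodeFP (pairE (pairE unE natE) natE) natE (fun y => y.1.2) := (fst _ _).snd'
  have hj : CodeFP (pairE (pairE unE natE) natE) unE (fun y => min y.2 y.1.1) := unOfNatMin.comp (ht.pair (snd _ _))
  have hd : CodeFP (pairE (pairE unE natE) natE) (zmodE p) (fun y => ((y.1.2 / p ^ min y.2 y.1.1 : ℕ) : ZMod p)) :=
    zmodOfNat.comp (natDiv.comp (hi.pair (natPow.comp ((const _ p).pair hj))))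
  have hm := (map hd).comp ((CodeFP.id (pairE unE natE)).pair (urange.comp (fst unE natE)))
  refine hm.congr fun x => ?_
  rw [digitsL_eq_map]
  refine List.map_congr_left fun j hj => ?_
  rw [List.mem_range] at hj
  simp only [id_eq]
  rw [min_eq_left hj.le, ← ZMod.natCast_mod (x.2 / p ^ j) p]

omit hp in
/-- `idxL [] = 0`. [folklore] -/
theorem idxL_nil : idxL p [] = 0 := by simp [idxL]

omit hp in
/-- `idxL (c :: l) = c + p · idxL l`. [folklore] -/
theorem idxL_cons (c : ZMod p) (l : List (ZMod p)) : idxL p (c :: l) = c.val + p * idxL p l := by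
  rw [idxL, idxL, List.length_cons, Finset.sum_range_succ', Finset.mul_sum]
  simp only [List.getD_cons_succ, List.getD_cons_zero, pow_zero, mul_one]
  rw [add_comm]
  congr 1
  exact Finset.sum_congr rfl fun j _ => by ring

/-- The step of the index loop on `(Σ_{j<i} l[j] pʲ, pⁱ)`. [folklore] -/
def idxStep (p : ℕ) (s : ℕ × ℕ) (c : ZMod p) : ℕ × ℕ := (s.1 + c.val * s.2, s.2 * p)

omit hp in
/-- The index loop computes `idxL` and the power. [folklore] -/
theorem foldl_idxStep : ∀ (l : List (ZMod p)) (a w : ℕ), l.foldl (idxStep p) (a, w) = (a + w * idxL p l, w * p ^ l.length)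
  | [], a, w => by simp [idxL_nil]
  | c :: l, a, w => by
    rw [List.foldl_cons, show idxStep p (a, w) c = (a + c.val * w, w * p) from rfl, foldl_idxStep l, idxL_cons,
      List.length_cons, pow_succ']
    refine Prod.ext ?_ ?_ <;> simp <;> ring

/-- **`idxL` on codes**: the index `Σⱼ l[j] pʲ` of a row. [folklore] -/
theorem codeFP_idxL : CodeFP (rowE p) natE (idxL p) := by
  have hstep : CodeFP (pairE (zmodE p) (pairE natE natE)) (pairE natE natE) (fun t => idxStep p t.2 t.1) :=
    (natAdd.comp ((snd _ _).fst'.pair (natMul.comp ((zmodVal.comp (fst _ _)).pair (snd _ _).snd')))).pair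
      (natMul.comp ((snd _ _).snd'.pair (const _ p)))
  have h := foldl₀ (α := ZMod p) (β := ℕ × ℕ) (eα := zmodE p) (eβ := pairE natE natE)
    (step := fun c s => idxStep p s c) (b₀ := ((0 : ℕ), (1 : ℕ))) hstep (C (3 * (natE p).length + 6) * X + C 6) (fun l₁ l₂ => by
      rw [foldl_idxStep, zero_add, one_mul, one_mul, pairE_apply, length_boolPair]
      simp only [eval_add, eval_mul, eval_C, eval_X]
      have h1 : (natE (idxL p l₁)).length ≤ l₁.length * (natE p).length + 1 :=
        (length_encodeNat_mono (idxL_lt p l₁).le).trans (length_natE_pow_le p _)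
      have h2 : (natE (p ^ l₁.length)).length ≤ l₁.length * (natE p).length + 1 := length_natE_pow_le p _
      have h3 : l₁.length ≤ (rawE (zmodE p) (l₁ ++ l₂)).length :=
        le_trans (by simp) (length_le_length_rawE (zmodE p) (l₁ ++ l₂))
      have h4 : l₁.length * (natE p).length ≤ (rawE (zmodE p) (l₁ ++ l₂)).length * (natE p).length := Nat.mul_le_mul_right _ h3
      have h5 : (3 * (natE p).length + 6) * (rawE (zmodE p) (l₁ ++ l₂)).length =
          3 * ((rawE (zmodE p) (l₁ ++ l₂)).length * (natE p).length) + 6 * (rawE (zmodE p) (l₁ ++ l₂)).length := by ring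
      rw [h5]
      omega)
  exact h.fst'.congr fun l => by rw [foldl_idxStep]; simp

/-! ### Candidates and the reducibility test -/

/-- **`monicL` on codes** (`d` binary, capped at `t`; the cap is inactive for `d < t`): `(1ᵗ, d, i) ↦
digits ++ [1] ++ 0^{t-d-1}`. [folklore] -/
theorem codeFP_monicL : CodeFP (pairE unE (pairE natE natE)) (rowE p) (fun x => monicL p x.1 (min x.2.1 x.1) x.2.2) := by
  have ht : CodeFP (pairE unE (pairE natE natE)) unE (fun x => x.1) := fst _ _
  have hd : CodeFP (pairE unE (pairE natE natE)) natE (fun x => x.2.1) := (snd _ _).fst'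
  have hi : CodeFP (pairE unE (pairE natE natE)) natE (fun x => x.2.2) := (snd _ _).snd'
  have hdu : CodeFP (pairE unE (pairE natE natE)) unE (fun x => min x.2.1 x.1) := unOfNatMin.comp (ht.pair hd)
  have hdig : CodeFP (pairE unE (pairE natE natE)) (rowE p) (fun x => digitsL p (min x.2.1 x.1) x.2.2) :=
    codeFP_digitsL.comp (hdu.pair hi)
  have hcnt : CodeFP (pairE unE (pairE natE natE)) unE (fun x => min (x.1 - x.2.1 - 1) x.1) :=
    unOfNatMin.comp (ht.pair (natSub.comp ((natSub.comp ((natOfUn.comp ht).pair hd)).pair (const _ 1))))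
  have hzeros : CodeFP (pairE unE (pairE natE natE)) (rowE p) (fun x => List.replicate (min (x.1 - x.2.1 - 1) x.1) (0 : ZMod p)) :=
    (replicateOf (zmodE p)).comp ((const _ (0 : ZMod p)).pair hcnt)
  refine (((rawAppend (zmodE p)).comp (hdig.pair ((rawCons (zmodE p)).comp ((const _ (1 : ZMod p)).pair hzeros)))).congr
    fun x => ?_)
  obtain ⟨t, d, i⟩ := x
  simp only [monicL, List.append_assoc, List.singleton_append]
  rw [show t - min d t - 1 = min (t - d - 1) t by omega]

/-- The test of one pair of candidates, on `((1^Q, q), d, i, j)` with caps (inactive for `d < |q|`). [folklore] -/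
theorem codeFP_pairTest :
    CodeFP (pairE (pairE (pairE (pairE unE (rowE p)) natE) natE) natE) bitE
      (fun y => decide (mulmodL p y.1.1.1.2 (monicL p y.1.1.1.2.length (min y.1.1.2 y.1.1.1.2.length) y.1.2)
        (monicL p y.1.1.1.2.length (min (y.1.1.1.2.length - y.1.1.2) y.1.1.1.2.length) y.2) =
          List.replicate y.1.1.1.2.length 0)) := by
  have hq : CodeFP (pairE (pairE (pairE (pairE unE (rowE p)) natE) natE) natE) (rowE p) (fun y => y.1.1.1.2) :=
    (fst _ _).fst'.fst'.snd'
  have hd : CodeFP (pairE (pairE (pairE (pairE unE (rowE p)) natE) natE) natE) natE (fun y => y.1.1.2) := (fst _ _).fst'.snd'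
  have hi : CodeFP (pairE (pairE (pairE (pairE unE (rowE p)) natE) natE) natE) natE (fun y => y.1.2) := (fst _ _).snd'
  have hj : CodeFP (pairE (pairE (pairE (pairE unE (rowE p)) natE) natE) natE) natE (fun y => y.2) := snd _ _
  have ht : CodeFP (pairE (pairE (pairE (pairE unE (rowE p)) natE) natE) natE) unE (fun y => y.1.1.1.2.length) :=
    (ulength (zmodE p)).comp hq
  have htb : CodeFP (pairE (pairE (pairE (pairE unE (rowE p)) natE) natE) natE) natE (fun y => y.1.1.1.2.length) :=
    (natLength (zmodE p)).comp hq
  have hf : CodeFP (pairE (pairE (pairE (pairE unE (rowE p)) natE) natE) natE) (rowE p)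
      (fun y => monicL p y.1.1.1.2.length (min y.1.1.2 y.1.1.1.2.length) y.1.2) := codeFP_monicL.comp (ht.pair (hd.pair hi))
  have hg : CodeFP (pairE (pairE (pairE (pairE unE (rowE p)) natE) natE) natE) (rowE p)
      (fun y => monicL p y.1.1.1.2.length (min (y.1.1.1.2.length - y.1.1.2) y.1.1.1.2.length) y.2) :=
    codeFP_monicL.comp (ht.pair ((natSub.comp (htb.pair hd)).pair hj))
  have hz : CodeFP (pairE (pairE (pairE (pairE unE (rowE p)) natE) natE) natE) (rowE p)
      (fun y => List.replicate y.1.1.1.2.length (0 : ZMod p)) := (replicateOf (zmodE p)).comp ((const _ (0 : ZMod p)).pair ht)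
  exact (CodeFP.eq (rawE_injective zmodE_injective)).comp ((codeFP_mulmodL.comp (hq.pair (hf.pair hg))).pair hz)

/-- **The reducibility test on codes**: `(1^Q, q) ↦ reducibleL p Q q`. [folklore] -/
theorem codeFP_reducibleL : CodeFP (pairE unE (rowE p)) bitE (fun x => reducibleL p x.1 x.2) := by
  -- innermost: over `j`
  have h3 := any (codeFP_pairTest (p := p))
  -- over `i`: context `((1^Q, q), d)`, item `i`
  have hQ2 : CodeFP (pairE (pairE (pairE unE (rowE p)) natE) natE) unE (fun y => y.1.1.1) := (fst _ _).fst'.fst'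
  have h2 := any (h3.comp ((CodeFP.id _).pair (urange.comp hQ2)))
  -- over `d`: context `(1^Q, q)`, item `d`
  have hQ1 : CodeFP (pairE (pairE unE (rowE p)) natE) unE (fun y => y.1.1) := (fst _ _).fst'
  have hd1 : CodeFP (pairE (pairE unE (rowE p)) natE) bitE (fun y => decide (1 ≤ y.2)) := natLe.comp ((const _ 1).pair (snd _ _))
  have h1 := any (hd1.and (h2.comp ((CodeFP.id _).pair (urange.comp hQ1))))
  have h0 := h1.comp ((CodeFP.id _).pair (urange.comp ((ulength (zmodE p)).comp (snd unE (rowE p)))))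
  refine h0.congr fun x => ?_
  obtain ⟨Q, q⟩ := x
  simp only [reducibleL, id_eq]
  refine any_congr_mem fun d hd => ?_
  rw [List.mem_range] at hd
  simp only [min_eq_left hd.le, min_eq_left (Nat.sub_le _ _)]

/-! ### The search, the exponent, the modulus -/

/-- **The search on codes**: `(1ᵗ, 1^Q) ↦ irredSearch p t Q`. [cite: CarmosinoImpagliazzoKabanetsKolokolova2016, Thm. 3.6 (proof)] -/
theorem codeFP_irredSearch : CodeFP (pairE unE unE) natE (fun x => irredSearch p x.1 x.2) := by
  have htest : CodeFP (pairE (pairE unE unE) natE) bitE (fun y => irredTest p y.1.1 y.1.2 y.2) :=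
    (codeFP_reducibleL.comp ((fst _ _).snd'.pair (codeFP_digitsL.comp ((fst _ _).fst'.pair (snd _ _))))).not.congr
      fun y => rfl
  have hfind := (rawFind? htest).comp ((CodeFP.id (pairE unE unE)).pair (urange.comp (snd unE unE)))
  have hget := optCases (σ := (ℕ × ℕ) × ℕ) (eσ := pairE (pairE unE unE) natE) (eα := natE) (eδ := natE)
    (k := fun _ o => o.getD 0) (gnone := fun _ => 0) (gsome := fun y => y.2) (const _ 0) (snd _ _)
    (fun _ => rfl) (fun _ _ => rfl)
  exact (hget.comp (((CodeFP.id _).pair (const _ 0)).pair hfind)).congr fun x => rfl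

omit hp in
/-- **The exponent on codes**: `1^Q ↦ 1^{tOf p Q}`. [folklore] -/
theorem codeFP_tOf : CodeFP unE unE (tOf p) := by
  have hQ : CodeFP (pairE unE natE) unE (fun y => y.1) := fst _ _
  have he : CodeFP (pairE unE natE) unE (fun y => min (y.2 + 1) y.1) :=
    unOfNatMin.comp (hQ.pair (natAdd.comp ((snd _ _).pair (const _ 1))))
  have hb : CodeFP (pairE unE natE) bitE (fun y => decide (p ^ min (y.2 + 1) y.1 ≤ y.1)) :=
    natLeUn.comp ((natPow.comp ((const _ p).pair he)).pair hQ)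
  have hf := ((ulength natE).comp ((filter hb).comp ((CodeFP.id unE).pair urange)))
  refine hf.congr fun Q => ?_
  simp only [tOf, id_eq]
  congr 1
  refine List.filter_congr fun i hi => ?_
  rw [List.mem_range] at hi
  simp only [min_eq_left (Nat.succ_le_of_lt hi)]

/-- **The modulus on codes**: `1^Q ↦ qOf p Q`. [folklore] -/
theorem codeFP_qOf : CodeFP unE (rowE p) (qOf p) :=
  (codeFP_digitsL.comp (codeFP_tOf.pair (codeFP_irredSearch.comp (codeFP_tOf.pair (CodeFP.id unE))))).congr fun _ => rfl

/-! ### Bits of a raw string and the column value -/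

omit hp in
/-- Reading bit `j` of a raw string by cutting. [folklore] -/
private theorem decide_drop_take_eq (s : List Bool) (j : ℕ) : decide ((s.drop j).take 1 = [true]) = s.getD j false := by
  by_cases h : j < s.length
  · rw [List.take_one_drop_eq_of_lt_length h, List.getD_eq_getElem _ _ h]
    cases hb : s[j] <;> simp [hb]
  · push Not at h
    rw [List.drop_of_length_le h, List.take_nil, List.getD_eq_default _ _ h]
    simp

/-- **`bitsOf` on codes**: `(1^ℓ, vbits) ↦` the first `ℓ` bits (default `false`). [folklore] -/
theorem codeFP_bitsOf : CodeFP (pairE unE strE) (rawE bitE) (fun x => bitsOf x.1 x.2) := by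
  have hℓ : CodeFP (pairE (pairE unE strE) natE) unE (fun y => y.1.1) := (fst _ _).fst'
  have hs : CodeFP (pairE (pairE unE strE) natE) strE (fun y => y.1.2) := (fst _ _).snd'
  have hj : CodeFP (pairE (pairE unE strE) natE) unE (fun y => min y.2 y.1.1) := unOfNatMin.comp (hℓ.pair (snd _ _))
  have hcut : CodeFP (pairE (pairE unE strE) natE) strE (fun y => (y.1.2.drop (min y.2 y.1.1)).take 1) :=
    strTake.comp ((const _ 1).pair (strDrop.comp (hj.pair hs)))
  have hbit : CodeFP (pairE (pairE unE strE) natE) bitE (fun y => decide ((y.1.2.drop (min y.2 y.1.1)).take 1 = [true])) :=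
    (CodeFP.eq (eα := strE) (fun _ _ h => h)).comp (hcut.pair (const _ [true]))
  have hm := (map hbit).comp ((CodeFP.id (pairE unE strE)).pair (urange.comp (fst unE strE)))
  refine hm.congr fun x => ?_
  rw [bitsOf, ofFn_eq_map_range (fun j => x.2.getD j false)]
  refine List.map_congr_left fun j hj => ?_
  rw [List.mem_range] at hj
  simp only [id_eq, min_eq_left hj.le, decide_drop_take_eq]

/-- **The column value on codes**: `(1^Q, 1^ℓ, vbits, τ) ↦ colValL p Q ℓ vbits τ` — the learner
recomputes the positions of the `AC⁰[p]`-computable design in polynomial time.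
[cite: CarmosinoImpagliazzoKabanetsKolokolova2016, Thm. 3.6] -/
theorem codeFP_colValL :
    CodeFP (pairE unE (pairE unE (pairE strE natE))) natE (fun x => colValL p x.1 x.2.1 x.2.2.1 x.2.2.2) := by
  have hQ : CodeFP (pairE unE (pairE unE (pairE strE natE))) unE (fun x => x.1) := fst _ _
  have hℓ : CodeFP (pairE unE (pairE unE (pairE strE natE))) unE (fun x => x.2.1) := (snd _ _).fst'
  have hv : CodeFP (pairE unE (pairE unE (pairE strE natE))) strE (fun x => x.2.2.1) := (snd _ _).snd'.fst'
  have hτ : CodeFP (pairE unE (pairE unE (pairE strE natE))) natE (fun x => x.2.2.2) := (snd _ _).snd'.snd'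
  have ht : CodeFP (pairE unE (pairE unE (pairE strE natE))) unE (fun x => tOf p x.1) := codeFP_tOf.comp hQ
  have hq : CodeFP (pairE unE (pairE unE (pairE strE natE))) (rowE p) (fun x => qOf p x.1) := codeFP_qOf.comp hQ
  have hb : CodeFP (pairE unE (pairE unE (pairE strE natE))) (rawE bitE) (fun x => bitsOf x.2.1 x.2.2.1) :=
    codeFP_bitsOf.comp (hℓ.pair hv)
  have hr : CodeFP (pairE unE (pairE unE (pairE strE natE))) (rowE p) (fun x => digitsL p (tOf p x.1) x.2.2.2) :=
    codeFP_digitsL.comp (ht.pair hτ)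
  exact (codeFP_idxL.comp (codeFP_polyValL.comp (hq.pair (hb.pair hr)))).congr fun x => rfl

end GFDesign

end Literature.Computability.MetaComplexity
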